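import Summits.CriticalPhenomena.Ising3DConformalLimit.Theses.ReflectionTwin
import HarnessLib

/-!
# Item stmt-CriticalPhenomena-16914 `ReflectionTwin.Assembly` — proved (it is the route's deciding theorem)

Route `ReflectionTwin` (sub-problem `CriticalPhenomena/Ising3DConformalLimit`), assembly item:
`TwinThreshold → TwinTransparency → ExistsContinuousLimit → TwinRotationGlue → InversionUpgradeNormalised →
IsingEuclidUpgradeR4NonGaussian → Ising3DConformalLimit` — the hypotheses and conclusion of the planner-authored
deciding theorem `ReflectionTwin.closes`, in the same order. Recorded by the lead of line `Sketch` of this route's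
existence crux (stmt-4582), as the grounder's attached closure (g79-3). [folklore]
-/

namespace Summit.CriticalPhenomena.Ising3DConformalLimit.ReflectionTwinAssembly

/-- **Item stmt-CriticalPhenomena-16914**: `ReflectionTwin.Assembly` is the deciding theorem `ReflectionTwin.closes`. [folklore] -/
theorem assembly_proof : Summit.CriticalPhenomena.Ising3DConformalLimit.Theses.ReflectionTwin.Assembly :=
  Summit.CriticalPhenomena.Ising3DConformalLimit.Theses.ReflectionTwin.closes

end Summit.CriticalPhenomena.Ising3DConformalLimit.ReflectionTwinAssembly
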